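import Summits.BirchSwinnertonDyer.Rank1Residual.JET.CarrierReadingRecordsKitFed
import Summits.BirchSwinnertonDyer.Rank1Residual.JET.JetDocstrikeDatumRecords01
import Summits.BirchSwinnertonDyer.Rank1Residual.JET.JetDocstrikeDatumRecords02
import Summits.BirchSwinnertonDyer.Rank1Residual.JET.JetDocstrikeDatumRecords03
import Summits.BirchSwinnertonDyer.Rank1Residual.JET.JetDocstrikeDatumRecords06
import Summits.BirchSwinnertonDyer.Rank1Residual.JET.JetDocstrikeARecords05
import HarnessLib

/-!
# T1 JET (cell `bsd-jet`): six LANDED by-name records FED BY NAME — `hrec`, `hD36` supplied by Literature theorems,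
# `hlev` by modularity (worked instances of `CarrierReadingRecordsKitFed` §0 on rows of record)

HONEST FRAMING (programme `BSD-LIT2PART-PROGRAMME-v1.md` §HONESTY, verbatim): «no tranche here proves BSD;
ARM L moves the LITERAL column of an r ≤ 1 census into the kernel-proved-modulo-named-print column; ARM P
changes what «named print» is worth.» THEOREMS ONLY; nothing is booked by this file. Seat `bsd-jet-ty`, g6.

WHAT THIS FILE IS. One landed record per record door of the DOCSTRIKE / DATUM-ADDENDUM by-name samples —
`bsdpJ_94017bb1_11` (A5), `bsdpJ_491205m1_11` (B5), `bsdpJ_346080cg1_3` (B3), `bsdpJ_321300bn1_3` (prover door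
CarrierAdd, additive `3`), `bsdpJ_305490l1_3` (A3F), `bsdpJ_371868b1_3` (A3F-tamX) — re-derived with the three
inherited binders FED: `hrec ↦ heegnerPointOfConductor_one_galoisConj_forall` (Literature theorem
`heegnerPointOfConductor_one_galoisConj_holds`, Darmon Thm. 3.7 / Gross 1991 §4), `hD36 ↦ fun N _ W K _ _ =>
phi_heegnerTau_mem_singularModuliField_holds N W K` (Darmon Thm. 3.6; the tree's
`GoldfeldGoodTwists.phi_heegnerTau_mem_singularModuliField_all`), `hlev ↦
level_eq_conductorNorm_forall_of_exists_isNewformOf hmod` (Carayol from modularity). The kernel data of each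
record (literal model, minimality, image / tower witnesses, Tamagawa certificate) is NOT re-checked here: the
landed record theorem is applied by name with every remaining binder passed by name. This is the recipe for all
≈ 250 landed `JET.bsdpJ_*` rows (files `JetDocstrikeARecords01–07`, `JetDocstrikeBRecords01–07`,
`JetDocstrikeDatumRecords01–13`) and, door by door, for the R-IDX / D1 samples. PARTITION: row D5 `JET@p∣N` —
0 classes moved by this file.

References: H. Darmon, CBMS 101 (2004) Thm. 3.6 / 3.7 [Darmon2004]; B. H. Gross, LMS LN 153 (1991) §4
[GrossLMS1991]; Diamond–Shurman, GTM 228 (2005) Thm. 8.8.1 [DiamondShurman2005]; D. Jetchev, Compos. Math. 144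
(2008) Thm. 1.4, Cor. 1.5 [Jetchev2008].
-/

set_option autoImplicit false

noncomputable section

open scoped Classical

open IsDedekindDomain NumberField Rat.HeightOneSpectrum WeierstrassCurve Literature.NumberTheory.EllipticCurves
  Literature.NumberTheory.EllipticCurves.ModularForms
  Literature.NumberTheory.EllipticCurves.Rank1Residual
  Literature.NumberTheory.EllipticCurves.Rank1Residual.Typed
  Literature.NumberTheory.EllipticCurves.Rank1Residual.X11RankOneCertificates
  Summit.BirchSwinnertonDyer.BirchSwinnertonDyer.Rank1Residual
  Summit.BirchSwinnertonDyer.BirchSwinnertonDyer.Rank1Residual.IntModel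
  Summit.BirchSwinnertonDyer.BirchSwinnertonDyer.Rank1Residual.X11RankOne
  Summit.BirchSwinnertonDyer.BirchSwinnertonDyer.Rank2Observatory.Tam
  Summit.BirchSwinnertonDyer.Rank1Residual Summit.BirchSwinnertonDyer.Rank1Residual.X11b

namespace Summit.BirchSwinnertonDyer.Rank1Residual.JET

/-- **`bsdpJ_94017bb1_11` FED** — bucket A, `p = 11 ≥ 5`, door `bsdp_of_jetRowA5_tam_min` (DATUM-ADDENDUM A
sample, p508218): the LANDED record with its displayed binders `hrec`, `hD36` supplied by the Literature
theorems and `hlev` by the modularity binder `hmod`; statement otherwise verbatim (the Heegner datum, the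
index line and `#Ш_an` stay displayed). Displayed named print after feeding: `hJ`, `hMcU`, `hGZK`, `hKo`,
`hmod`. -/
theorem bsdpJ_94017bb1_11_fed
    (hJ : JetchevDivisibilityCarrierNe)
    (hMcU : McCallum1991_padicValNat_card_sha_primary_add_le_of_globalDivisibility)
    (hGZK : rank_eq_analyticRank_of_analyticRank_le_one)
    (hKo : ∀ (N : ℕ) [NeZero N] (W : WeierstrassCurve ℚ) (K : Type) [Field K] [NumberField K], kolyvagin N W K)
    (hmod : exists_isNewformOf) (W : WeierstrassCurve ℚ)
    (hW : W = ⟨0, 1, 1, -36442336, 48091324804⟩) {N : ℕ} [NeZero N] {K : Type} [Field K]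
    [NumberField K] (hK : IsImaginaryQuadratic K) (hD3 : NumberField.discr K ≠ -3)
    (hD4 : NumberField.discr K ≠ -4) (hH : SatisfiesHeegnerHypothesis N K)
    {P : (W.baseChange K).toAffine.Point} (hP : IsHeegnerPoint N W K P) (hnt : ¬ IsOfFinAddOrder P)
    (hqN : 3 ∣ N) (hv : padicValNat 11 (AddSubgroup.zmultiples P).index ≤ 1)
    (hr : W.analyticRank ≤ 1) {s : ℚ} (hs : shaAn W = (s : ℂ)) (hvs : padicValRat 11 s = 0) :
    BSDp W 11 :=
  bsdpJ_94017bb1_11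
    (hJ := hJ) (hMcU := hMcU) (hGZK := hGZK) (hKo := hKo)
    (hrec := heegnerPointOfConductor_one_galoisConj_forall)
    (hD36 := (fun N _ W K _ _ => phi_heegnerTau_mem_singularModuliField_holds N W K))
    (hlev := (level_eq_conductorNorm_forall_of_exists_isNewformOf hmod)) (W := W) (hW := hW)
    (hK := hK) (hD3 := hD3) (hD4 := hD4) (hH := hH) (hP := hP) (hnt := hnt) (hqN := hqN) (hv := hv)
    (hr := hr) (hs := hs) (hvs := hvs)

/-- **`bsdpJ_491205m1_11` FED** — bucket B, `p = 11`, door `bsdp_of_jetRowB5_tam_min` (DATUM-ADDENDUM B sample,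
p506136): the LANDED record with its displayed binders `hrec`, `hD36` supplied by the Literature theorems
and `hlev` by the modularity binder `hmod`; statement otherwise verbatim (the Heegner datum, the index line
and `#Ш_an` stay displayed). Displayed named print after feeding: `hJ`, `hMcU`, `hGZK`, `hKo`, `hmod`. -/
theorem bsdpJ_491205m1_11_fed
    (hJ : JetchevDivisibilityCarrierMult)
    (hMcU : McCallum1991_padicValNat_card_sha_primary_add_le_of_globalDivisibility)
    (hGZK : rank_eq_analyticRank_of_analyticRank_le_one)
    (hKo : ∀ (N : ℕ) [NeZero N] (W : WeierstrassCurve ℚ) (K : Type) [Field K] [NumberField K], kolyvagin N W K)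
    (hmod : exists_isNewformOf) (W : WeierstrassCurve ℚ) (hW : W = ⟨0, 1, 1, 5324155, -190025026⟩)
    {N : ℕ} [NeZero N] {K : Type} [Field K] [NumberField K] (hK : IsImaginaryQuadratic K)
    (hD3 : NumberField.discr K ≠ -3) (hD4 : NumberField.discr K ≠ -4)
    (hH : SatisfiesHeegnerHypothesis N K) {P : (W.baseChange K).toAffine.Point}
    (hP : IsHeegnerPoint N W K P) (hnt : ¬ IsOfFinAddOrder P)
    (hv : padicValNat 11 (AddSubgroup.zmultiples P).index ≤ 1) (hr : W.analyticRank ≤ 1) {s : ℚ}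
    (hs : shaAn W = (s : ℂ)) (hvs : padicValRat 11 s = 0) :
    BSDp W 11 :=
  bsdpJ_491205m1_11
    (hJ := hJ) (hMcU := hMcU) (hGZK := hGZK) (hKo := hKo)
    (hrec := heegnerPointOfConductor_one_galoisConj_forall)
    (hD36 := (fun N _ W K _ _ => phi_heegnerTau_mem_singularModuliField_holds N W K))
    (hlev := (level_eq_conductorNorm_forall_of_exists_isNewformOf hmod)) (W := W) (hW := hW)
    (hK := hK) (hD3 := hD3) (hD4 := hD4) (hH := hH) (hP := hP) (hnt := hnt) (hv := hv) (hr := hr)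
    (hs := hs) (hvs := hvs)

/-- **`bsdpJ_346080cg1_3` FED** — bucket B, `p = 3` split at `3`, door `bsdp_of_jetRowB3_tam_min` (p508066): the
LANDED record with its displayed binders `hrec`, `hD36` supplied by the Literature theorems and `hlev` by
the modularity binder `hmod`; statement otherwise verbatim (the Heegner datum, the index line and `#Ш_an`
stay displayed). Displayed named print after feeding: `hJ`, `hMcU`, `hGZK`, `hKo`, `hmod`. -/
theorem bsdpJ_346080cg1_3_fed
    (hJ : JetchevDivisibilityCarrierMult)
    (hMcU : McCallum1991_padicValNat_card_sha_primary_add_le_of_globalDivisibility)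
    (hGZK : rank_eq_analyticRank_of_analyticRank_le_one)
    (hKo : ∀ (N : ℕ) [NeZero N] (W : WeierstrassCurve ℚ) (K : Type) [Field K] [NumberField K], kolyvagin N W K)
    (hmod : exists_isNewformOf) (W : WeierstrassCurve ℚ) (hW : W = ⟨0, 1, 0, -246, -936⟩) {N : ℕ}
    [NeZero N] {K : Type} [Field K] [NumberField K] (hK : IsImaginaryQuadratic K)
    (hD3 : NumberField.discr K ≠ -3) (hD4 : NumberField.discr K ≠ -4)
    (hH : SatisfiesHeegnerHypothesis N K) {P : (W.baseChange K).toAffine.Point}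
    (hP : IsHeegnerPoint N W K P) (hnt : ¬ IsOfFinAddOrder P)
    (hv : padicValNat 3 (AddSubgroup.zmultiples P).index ≤ 1) (hr : W.analyticRank ≤ 1) {s : ℚ}
    (hs : shaAn W = (s : ℂ)) (hvs : padicValRat 3 s = 0) :
    BSDp W 3 :=
  bsdpJ_346080cg1_3
    (hJ := hJ) (hMcU := hMcU) (hGZK := hGZK) (hKo := hKo)
    (hrec := heegnerPointOfConductor_one_galoisConj_forall)
    (hD36 := (fun N _ W K _ _ => phi_heegnerTau_mem_singularModuliField_holds N W K))
    (hlev := (level_eq_conductorNorm_forall_of_exists_isNewformOf hmod)) (W := W) (hW := hW)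
    (hK := hK) (hD3 := hD3) (hD4 := hD4) (hH := hH) (hP := hP) (hnt := hnt) (hv := hv) (hr := hr)
    (hs := hs) (hvs := hvs)

/-- **`bsdpJ_321300bn1_3` FED** — bucket B, `p = 3` ADDITIVE at `3`, prover door
`bsdp_of_jetRowCarrierAdd_three_of_frobenius` (p506496): the LANDED record with its displayed binders
`hrec`, `hD36` supplied by the Literature theorems and `hlev` by the modularity binder `hmod`; statement
otherwise verbatim (the Heegner datum, the index line and `#Ш_an` stay displayed). Displayed named print
after feeding: `hJ`, `hMcU`, `hGZK`, `hKo`, `hmod`. -/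
theorem bsdpJ_321300bn1_3_fed
    (hJ : JetchevDivisibilityCarrierAdd)
    (hMcU : McCallum1991_padicValNat_card_sha_primary_add_le_of_globalDivisibility)
    (hGZK : rank_eq_analyticRank_of_analyticRank_le_one)
    (hKo : ∀ (N : ℕ) [NeZero N] (W : WeierstrassCurve ℚ) (K : Type) [Field K] [NumberField K], kolyvagin N W K)
    (hmod : exists_isNewformOf) (W : WeierstrassCurve ℚ) (hW : W = ⟨0, 0, 0, 12825, -10307250⟩)
    {N : ℕ} [NeZero N] {K : Type} [Field K] [NumberField K] (hK : IsImaginaryQuadratic K)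
    (hD3 : NumberField.discr K ≠ -3) (hD4 : NumberField.discr K ≠ -4)
    (hH : SatisfiesHeegnerHypothesis N K) {P : (W.baseChange K).toAffine.Point}
    (hP : IsHeegnerPoint N W K P) (hnt : ¬ IsOfFinAddOrder P)
    (hI : padicValNat 3 (AddSubgroup.zmultiples P).index ≤
      padicValNat 3 ((W.baseChange ℚ_[3]).localTamagawaNumber ℤ_[3]))
    (hr : W.analyticRank ≤ 1) {s : ℚ} (hs : shaAn W = (s : ℂ)) (hvs : padicValRat 3 s = 0) :
    BSDp W 3 :=
  bsdpJ_321300bn1_3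
    (hJ := hJ) (hMcU := hMcU) (hGZK := hGZK) (hKo := hKo)
    (hrec := heegnerPointOfConductor_one_galoisConj_forall)
    (hD36 := (fun N _ W K _ _ => phi_heegnerTau_mem_singularModuliField_holds N W K))
    (hlev := (level_eq_conductorNorm_forall_of_exists_isNewformOf hmod)) (W := W) (hW := hW)
    (hK := hK) (hD3 := hD3) (hD4 := hD4) (hH := hH) (hP := hP) (hnt := hnt) (hI := hI) (hr := hr)
    (hs := hs) (hvs := hvs)

/-- **`bsdpJ_305490l1_3` FED** — bucket A, `p = 3`, door `bsdp_of_jetRowA3F_tam_min` (DOCSTRIKE-A sample,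
p481537): the LANDED record with its displayed binders `hrec`, `hD36` supplied by the Literature theorems
and `hlev` by the modularity binder `hmod`; statement otherwise verbatim (the Heegner datum, the index line
and `#Ш_an` stay displayed). Displayed named print after feeding: `hJ`, `hMcU`, `hGZK`, `hKo`, `hmod`. -/
theorem bsdpJ_305490l1_3_fed
    (hJ : JetchevDivisibilityCarrierNe)
    (hMcU : McCallum1991_padicValNat_card_sha_primary_add_le_of_globalDivisibility)
    (hGZK : rank_eq_analyticRank_of_analyticRank_le_one)
    (hKo : ∀ (N : ℕ) [NeZero N] (W : WeierstrassCurve ℚ) (K : Type) [Field K] [NumberField K], kolyvagin N W K)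
    (hmod : exists_isNewformOf) (W : WeierstrassCurve ℚ) (hW : W = ⟨1, 1, 1, -3741, -98637⟩) {N : ℕ}
    [NeZero N] {K : Type} [Field K] [NumberField K] (hK : IsImaginaryQuadratic K)
    (hD3 : NumberField.discr K ≠ -3) (hD4 : NumberField.discr K ≠ -4)
    (hH : SatisfiesHeegnerHypothesis N K) {P : (W.baseChange K).toAffine.Point}
    (hP : IsHeegnerPoint N W K P) (hnt : ¬ IsOfFinAddOrder P) (hqN : 2 ∣ N)
    (hv : padicValNat 3 (AddSubgroup.zmultiples P).index ≤ 1) (hr : W.analyticRank ≤ 1) {s : ℚ}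
    (hs : shaAn W = (s : ℂ)) (hvs : padicValRat 3 s = 0) :
    BSDp W 3 :=
  bsdpJ_305490l1_3
    (hJ := hJ) (hMcU := hMcU) (hGZK := hGZK) (hKo := hKo)
    (hrec := heegnerPointOfConductor_one_galoisConj_forall)
    (hD36 := (fun N _ W K _ _ => phi_heegnerTau_mem_singularModuliField_holds N W K))
    (hlev := (level_eq_conductorNorm_forall_of_exists_isNewformOf hmod)) (W := W) (hW := hW)
    (hK := hK) (hD3 := hD3) (hD4 := hD4) (hH := hH) (hP := hP) (hnt := hnt) (hqN := hqN) (hv := hv)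
    (hr := hr) (hs := hs) (hvs := hvs)

/-- **`bsdpJ_371868b1_3` FED** — bucket A, `p = 3`, carrier of type `IV`/`IV*`, door
`bsdp_of_jetRowA3F_tamX_min` (p481537): the LANDED record with its displayed binders `hrec`, `hD36` supplied
by the Literature theorems and `hlev` by the modularity binder `hmod`; statement otherwise verbatim (the
Heegner datum, the index line and `#Ш_an` stay displayed). Displayed named print after feeding: `hJ`,
`hMcU`, `hGZK`, `hKo`, `hmod`. -/
theorem bsdpJ_371868b1_3_fed
    (hJ : JetchevDivisibilityCarrierNe)
    (hMcU : McCallum1991_padicValNat_card_sha_primary_add_le_of_globalDivisibility)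
    (hGZK : rank_eq_analyticRank_of_analyticRank_le_one)
    (hKo : ∀ (N : ℕ) [NeZero N] (W : WeierstrassCurve ℚ) (K : Type) [Field K] [NumberField K], kolyvagin N W K)
    (hmod : exists_isNewformOf) (W : WeierstrassCurve ℚ) (hW : W = ⟨0, -1, 0, -48945, 4612266⟩)
    {N : ℕ} [NeZero N] {K : Type} [Field K] [NumberField K] (hK : IsImaginaryQuadratic K)
    (hD3 : NumberField.discr K ≠ -3) (hD4 : NumberField.discr K ≠ -4)
    (hH : SatisfiesHeegnerHypothesis N K) {P : (W.baseChange K).toAffine.Point}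
    (hP : IsHeegnerPoint N W K P) (hnt : ¬ IsOfFinAddOrder P) (hqN : 2 ∣ N)
    (hv : padicValNat 3 (AddSubgroup.zmultiples P).index ≤ 1) (hr : W.analyticRank ≤ 1) {s : ℚ}
    (hs : shaAn W = (s : ℂ)) (hvs : padicValRat 3 s = 0) :
    BSDp W 3 :=
  bsdpJ_371868b1_3
    (hJ := hJ) (hMcU := hMcU) (hGZK := hGZK) (hKo := hKo)
    (hrec := heegnerPointOfConductor_one_galoisConj_forall)
    (hD36 := (fun N _ W K _ _ => phi_heegnerTau_mem_singularModuliField_holds N W K))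
    (hlev := (level_eq_conductorNorm_forall_of_exists_isNewformOf hmod)) (W := W) (hW := hW)
    (hK := hK) (hD3 := hD3) (hD4 := hD4) (hH := hH) (hP := hP) (hnt := hnt) (hqN := hqN) (hv := hv)
    (hr := hr) (hs := hs) (hvs := hvs)

end Summit.BirchSwinnertonDyer.Rank1Residual.JET
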